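import Mathlib
import Literature.Computability.AlgebraicComplexity.NestFreeMatchingPoly
import Literature.Computability.AlgebraicComplexity.ArithCircuitProofs
import Summits.ValiantsHypothesis.ValiantsHypothesis.Theorems.DivisionGapPerCofactorDegreeReductionStubMonomialStripping
import Summits.ValiantsHypothesis.ValiantsHypothesis.Theorems.FifoMatchingNNDivisionHardTorusHomogeneous
import HarnessLib

/-!
# Route FifoMatching — crux `NNDivisionHard` (stmt-ValiantsHypothesis-21181): FACE READING — a certificate computes, at
# polynomial cost, every face polynomial of `NN_n` whose direction is generic for its cofactor

A monotone certificate `(h, NN_n · h)` and an arc weight `w : arcs → ℕ`: top `w`-components are free for monotone circuits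
(`ZeroOneTransfer.Negative.complexity_topComponent_le`) and multiplicative over `ℝ≥0` (`topComponent_mul`), so
`top_w(NN_n · h) = top_w(NN_n) · top_w(h)` costs `≤ L₊(NN_n · h)`.  If `w` is GENERIC FOR `h` — a unique monomial `x^e` of `h`
has maximal `w`-weight — then `top_w(h) = c·x^e` is a monomial, and Jukna–Seiwert–Sergeev stripping
(`MonomialStripping.complexity_le_of_monomial_mul`: removing a monomial factor costs polynomially, whatever its degree) leaves the
FACE POLYNOMIAL `NN_n^w := top_w(NN_n)` (the sum over the `w`-maximal nest-free perfect matchings — the face of `NFP_n` in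
direction `w`):

* `topComponent_eq_monomial_of_unique_max` — genericity ⇒ `top_w(h) = monomial e (coeff e h)`;
* ★ `complexity_face_le_of_generic` — **`L₊(NN_n^w) ≤ 16((2n+1)(L₊(NN_n · h)+1))² + 1` for every `w` generic for `h`**;
* ★ `not_certificate_of_hard_generic_face` — contrapositive: if some direction generic for `h` has a face polynomial of cost
  `> 16((2n+1)(T+1))² + 1`, then `(h, NN_n·h)` is not a `T`-certificate (`L₊(NN_n·h) > T`).

USE (the programme this opens; not carried out here).  Hard faces of `NFP_n` abound: e.g. for `n = 3a` the direction
`w = B·𝟙_R + 𝟙_{pins}` (`R` = the rainbow arcs `(i, 2n−1−i)`, of which a nest-free matching contains at most ONE; pins = the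
rainbow arc `(2a, 4a−1)`, the order-preserving arcs `(2a+1+t, 4a+t)` and `(6a−2, 6a−1)`) has face polynomial
`x^{pins} · NN_a[0, 2a)` (cost `≥ 2^{a^{1/6}}` after stripping), while it is generic for every power `NC_n^k` of the STACK twin
(the rainbow is the unique noncrossing matching containing all rainbow arcs, so `top_w(NC_n^k) = x^{kR}`): hence the residual
test cofactor `h = NC_n^k` of the unsaturated tier is NOT a certificate either — «stack powers do not help the queue» — once the
face identification is typed (next hand: M-sized).  Complementary to the saturated-cofactor rung (which kills `NN_n^k`, for which
no hard direction is generic).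

HONEST FRAMING: an engine-level rung (monotone world); 21181 stays OPEN; nothing here bears on `NNNotVP` or VP ≠ VNP (NOT proved).
References: Jukna–Seiwert–Sergeev 2022 Thm 1 [JuknaSeiwertSergeev2022]; Hrubeš–Yehudayoff 2021 §6, Prop 43(3) [HrubesYehudayoff2021].
-/

noncomputable section

-- Sub = Summit single-conjunct layout: the duplicated namespace component is mandated by the tree.
set_option linter.dupNamespace false
set_option autoImplicit false

namespace Summit.ValiantsHypothesis.ValiantsHypothesis.Theorems.FifoMatching.NNDivisionHard.FaceReading

open MvPolynomial Literature.Computability.AlgebraicComplexity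
open Summit.ValiantsHypothesis.ValiantsHypothesis.Theorems.ZeroOneTransfer.Negative
  (topComponent coeff_topComponent topComponent_mul complexity_topComponent_le)
open Summit.ValiantsHypothesis.ValiantsHypothesis.Theorems.DivisionGap.PerCofactorDegreeReduction.MonomialStripping
  (complexity_le_of_monomial_mul)
open scoped NNReal BigOperators

variable {σ : Type*}

/-- **Genericity ⇒ the top component is a monomial**: if `e ∈ supp h` has strictly larger `w`-weight than every other
monomial of `h`, then `top_w(h) = monomial e (coeff e h)`. [folklore] -/
theorem topComponent_eq_monomial_of_unique_max (w : σ → ℕ) (h : MvPolynomial σ ℝ≥0) {e : σ →₀ ℕ}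
    (he : e ∈ h.support) (hgen : ∀ e' ∈ h.support, e' ≠ e → Finsupp.weight w e' < Finsupp.weight w e) :
    topComponent w h = monomial e (coeff e h) := by
  classical
  have hdeg : weightedTotalDegree w h = Finsupp.weight w e := by
    apply le_antisymm
    · unfold weightedTotalDegree
      refine Finset.sup_le fun d hd => ?_
      by_cases hde : d = e
      · rw [hde]
      · exact (hgen d hd hde).le
    · exact le_weightedTotalDegree w he
  refine MvPolynomial.ext _ _ fun d => ?_
  rw [coeff_topComponent, coeff_monomial, hdeg]
  by_cases hde : e = d
  · subst hde; simp
  · rw [if_neg hde]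
    split_ifs with hwd
    · by_contra hne
      have hd : d ∈ h.support := mem_support_iff.mpr hne
      exact absurd hwd (hgen d hd (Ne.symm hde)).ne
    · rfl

/-- ★ **FACE READING.**  For every nonzero-free datum: a cofactor `h`, an arc weight `w` GENERIC for `h` (a unique monomial
`x^e` of `h` of maximal `w`-weight), the face polynomial `NN_n^w = top_w(NN_n)` satisfies
`L₊(NN_n^w) ≤ 16((2n+1)(L₊(NN_n · h)+1))² + 1`: top components are free and multiplicative, the top of `h` is the monomial
`c·x^e`, and stripping it costs polynomially (JSS), whatever `deg x^e`. [cite: JuknaSeiwertSergeev2022, Thm 1]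
[cite: HrubesYehudayoff2021, Prop 43(3)] -/
theorem complexity_face_le_of_generic (n : ℕ) (w : Fin (2 * n) × Fin (2 * n) → ℕ)
    (h : MvPolynomial (Fin (2 * n) × Fin (2 * n)) ℝ≥0) {e : (Fin (2 * n) × Fin (2 * n)) →₀ ℕ}
    (he : e ∈ h.support) (hgen : ∀ e' ∈ h.support, e' ≠ e → Finsupp.weight w e' < Finsupp.weight w e) :
    complexity (topComponent w (nestFreeMatchingPoly n ℝ≥0)) ≤
      16 * ((2 * n + 1) * (complexity (nestFreeMatchingPoly n ℝ≥0 * h) + 1)) ^ 2 + 1 := by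
  classical
  set c : ℝ≥0 := coeff e h with hc_def
  have hc : c ≠ 0 := mem_support_iff.mp he
  set F := topComponent w (nestFreeMatchingPoly n ℝ≥0) with hF
  -- the top component of the certificate is `F · c x^e`, at no cost
  have htop : topComponent w (nestFreeMatchingPoly n ℝ≥0 * h) = F * monomial e c := by
    rw [topComponent_mul, topComponent_eq_monomial_of_unique_max w h he hgen]
  have h1 : complexity (F * monomial e c) ≤ complexity (nestFreeMatchingPoly n ℝ≥0 * h) := by
    rw [← htop]; exact complexity_topComponent_le w _
  -- `F · c x^e = x^e · (c • F)`; strip `x^e`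
  have heq : monomial e 1 * (c • F) = F * monomial e c :=
    calc monomial e 1 * (c • F) = monomial e 1 * (C c * F) := by rw [smul_eq_C_mul]
      _ = (C c * monomial e 1) * F := by rw [← mul_assoc, mul_comm (monomial e (1 : ℝ≥0)) (C c)]
      _ = monomial e c * F := by rw [C_mul_monomial, mul_one]
      _ = F * monomial e c := mul_comm (monomial e c) F
  have h2 := complexity_le_of_monomial_mul (2 * n) e (c • F)
  rw [heq] at h2
  -- undo the scalar
  have h3 : complexity F ≤ complexity (c • F) + 1 := by
    have := complexity_smul_le_holds c⁻¹ (c • F)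
    rwa [smul_smul, inv_mul_cancel₀ hc, one_smul] at this
  have h4 : 16 * ((2 * n + 1) * (complexity (F * monomial e c) + 1)) ^ 2 ≤
      16 * ((2 * n + 1) * (complexity (nestFreeMatchingPoly n ℝ≥0 * h) + 1)) ^ 2 :=
    Nat.mul_le_mul_left 16 (Nat.pow_le_pow_left (Nat.mul_le_mul_left _ (by omega)) 2)
  omega

/-- ★ **Contrapositive: a hard generic face kills the certificate.**  If some arc weight `w` generic for `h` has face
polynomial `NN_n^w` of cost `> 16((2n+1)(T+1))² + 1`, then `L₊(NN_n · h) > T`. [cite: JuknaSeiwertSergeev2022, Thm 1] -/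
theorem not_certificate_of_hard_generic_face (n T : ℕ) (w : Fin (2 * n) × Fin (2 * n) → ℕ)
    (h : MvPolynomial (Fin (2 * n) × Fin (2 * n)) ℝ≥0) {e : (Fin (2 * n) × Fin (2 * n)) →₀ ℕ}
    (he : e ∈ h.support) (hgen : ∀ e' ∈ h.support, e' ≠ e → Finsupp.weight w e' < Finsupp.weight w e)
    (hhard : 16 * ((2 * n + 1) * (T + 1)) ^ 2 + 1 < complexity (topComponent w (nestFreeMatchingPoly n ℝ≥0))) :
    T < complexity (nestFreeMatchingPoly n ℝ≥0 * h) := by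
  by_contra hle
  push Not at hle
  have h1 := complexity_face_le_of_generic n w h he hgen
  have h2 : 16 * ((2 * n + 1) * (complexity (nestFreeMatchingPoly n ℝ≥0 * h) + 1)) ^ 2 ≤
      16 * ((2 * n + 1) * (T + 1)) ^ 2 :=
    Nat.mul_le_mul_left 16 (Nat.pow_le_pow_left (Nat.mul_le_mul_left _ (by omega)) 2)
  omega

end Summit.ValiantsHypothesis.ValiantsHypothesis.Theorems.FifoMatching.NNDivisionHard.FaceReading

end
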